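/-
Copyright (c) 2026. All rights reserved.
Released under Apache 2.0 license as described in the file LICENSE.
Authors: HodgeCM publication cell (pub-hodgecm), GR lane, seat GR-2 (`pub-hodgecm-own-hyp34`).
-/
import Literature.NumberTheory.Automorphic.QuadraticArchimedeanBaseChange
import Mathlib.NumberTheory.NumberField.InfinitePlace.Ramification
import Mathlib.NumberTheory.NumberField.InfinitePlace.TotallyRealComplex
import Mathlib.FieldTheory.Galois.Basic
import HarnessLib

/-!
# Places of a quadratic extension `E/F` over the archimedean places of `F`, `E` totally complex

Topic `NumberTheory/Automorphic`; namespace `Literature.NumberTheory.Automorphic.UnitaryGroup`.  KERNEL ONLY: two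
definitions with bodies (choices of places) and theorems; no `def … : Prop` record, no axiom, no proof hole.

For a quadratic extension of number fields `E/F` with non-trivial automorphism `c`:

* §1 **a complex place `w` of `E` over a REAL place of `F` is fixed by `c`** (`smul_eq_of_isComplex_of_isReal_comap`):
  such a `w` is ramified, so its stabiliser in `Gal(E/F) ≅ ℤ/2` has two elements (Mathlib
  `not_isUnramified_iff_card_stabilizer_eq_two`), i.e. is everything;
* §2 for `E` TOTALLY COMPLEX: the choices **`placeOverReal v`** (the — unique — complex, `c`-fixed place over a real
  place `v`) and **`placeOverComplex v`** (a place over a complex place `v`), with their `comap` identities — the data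
  `(wOf, hw, hover)` consumed by the archimedean Weil section (`Weil1964.ArchUnitaryWeilHalf`, `…Gen`) at the real
  places, and `(wOf, hover)` at the complex places.

[PlatonovRapinchuk1994, §2.3 (archimedean places in quadratic extensions)]; [CasselsFrohlichANT1967, Ch. II §14].

## References
* [PlatonovRapinchuk1994] V. Platonov, A. Rapinchuk, *Algebraic Groups and Number Theory* (1994), §2.3.
* [CasselsFrohlichANT1967] J. W. S. Cassels, A. Fröhlich (eds.), *Algebraic Number Theory* (1967), Ch. II §14.
-/

set_option autoImplicit false

noncomputable section

open scoped Classical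
open NumberField NumberField.InfinitePlace

namespace Literature.NumberTheory.Automorphic

namespace UnitaryGroup

variable (F : Type) [Field F] [NumberField F] (E : Type) [Field E] [NumberField E] [Algebra F E]
  [Algebra.IsQuadraticExtension F E] (c : E ≃ₐ[F] E)

/-! ## §1 A complex place over a real place is fixed by the Galois involution -/

/-- the Galois group of a quadratic extension of number fields has two elements. [cite: PlatonovRapinchuk1994, §2.3] -/
theorem card_gal_eq_two : Nat.card (E ≃ₐ[F] E) = 2 := by
  haveI : IsGalois F E := Algebra.IsQuadraticExtension.isGalois F E
  rw [IsGalois.card_aut_eq_finrank, Algebra.IsQuadraticExtension.finrank_eq_two F E]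

/-- **a complex place of `E` over a real place of `F` is fixed by every element of `Gal(E/F)`** (it is ramified, so
its stabiliser has two elements, i.e. is the whole Galois group). [cite: PlatonovRapinchuk1994, §2.3] -/
theorem smul_eq_of_isComplex_of_isReal_comap (w : InfinitePlace E) (hw : w.IsComplex)
    (hv : (w.comap (algebraMap F E)).IsReal) : c • w = w := by
  haveI : IsGalois F E := Algebra.IsQuadraticExtension.isGalois F E
  have hram : ¬ IsUnramified F w := not_isUnramified_iff.mpr ⟨hw, hv⟩
  have hcard : Nat.card (MulAction.stabilizer (E ≃ₐ[F] E) w) = 2 :=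
    not_isUnramified_iff_card_stabilizer_eq_two.mp hram
  have htop : MulAction.stabilizer (E ≃ₐ[F] E) w = ⊤ :=
    Subgroup.eq_top_of_card_eq _ (by rw [hcard, card_gal_eq_two F E])
  have hc : c ∈ MulAction.stabilizer (E ≃ₐ[F] E) w := by rw [htop]; exact Subgroup.mem_top c
  exact MulAction.mem_stabilizer_iff.mp hc

/-! ## §2 The places over the archimedean places of `F`, for `E` totally complex -/

section TotallyComplex

variable [IsTotallyComplex E]

/-- **the place of `E` over a real place `v` of `F`** (a choice; complex since `E` is totally complex).
[cite: CasselsFrohlichANT1967, Ch. II §14] -/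
def placeOverReal (v : {v : InfinitePlace F // v.IsReal}) : {w : InfinitePlace E // w.IsComplex} :=
  ⟨(Classical.choice (InfPlacesOver.nonempty E v.1)).1, IsTotallyComplex.isComplex _⟩

/-- it lies over `v`. [cite: CasselsFrohlichANT1967, Ch. II §14] -/
theorem placeOverReal_comap (v : {v : InfinitePlace F // v.IsReal}) :
    (placeOverReal F E v).1.comap (algebraMap F E) = v.1 :=
  (Classical.choice (InfPlacesOver.nonempty E v.1)).2

/-- **it is fixed by the involution**: `c • w(v) = w(v)`. [cite: PlatonovRapinchuk1994, §2.3] -/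
theorem smul_placeOverReal (v : {v : InfinitePlace F // v.IsReal}) :
    c • (placeOverReal F E v).1 = (placeOverReal F E v).1 :=
  smul_eq_of_isComplex_of_isReal_comap F E c _ (placeOverReal F E v).2
    (by rw [placeOverReal_comap]; exact v.2)

/-- **a place of `E` over a complex place `v` of `F`** (a choice; the other one is `c • w(v)`).
[cite: CasselsFrohlichANT1967, Ch. II §14] -/
def placeOverComplex (v : {v : InfinitePlace F // v.IsComplex}) : {w : InfinitePlace E // w.IsComplex} :=
  ⟨(Classical.choice (InfPlacesOver.nonempty E v.1)).1, IsTotallyComplex.isComplex _⟩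

/-- it lies over `v`. [cite: CasselsFrohlichANT1967, Ch. II §14] -/
theorem placeOverComplex_comap (v : {v : InfinitePlace F // v.IsComplex}) :
    (placeOverComplex F E v).1.comap (algebraMap F E) = v.1 :=
  (Classical.choice (InfPlacesOver.nonempty E v.1)).2

end TotallyComplex

end UnitaryGroup

end Literature.NumberTheory.Automorphic

end
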